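import Literature.NumberTheory.IwasawaTheory.ClassicalMuVanishesRelativeKleinDescent
import HarnessLib

set_option autoImplicit false

/-!
# Growth-fact-free and Ferrero–Washington-free μ-descent for Galois groups of Zywina-`G₉` type
# (`5S4`, order 96: e.g. `ℚ(E[5])` with exceptional mod-5 image `G₉ ⊃ N_s(5)`, projective image `𝔖₄`)

Topic `NumberTheory/IwasawaTheory` (namespace = path).  THEOREM-ONLY file (no definition, no named fact, no `sorry`); literature
seat `bsd-potss-conjA-anchor` g12 (supports stmt-BirchSwinnertonDyer-19413, the KT rows with image `5S4` at `p = 5`, typed «structurally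
void» by the g10 norm-relation census; closes nothing).  Companion of `ClassicalMuVanishesNonsplitCartanFiveDescent` (`N_ns(5)`).

`L/ℚ` finite Galois, `p` odd, `p ∤ [L : ℚ]`, and `u, w, t ∈ G = Gal(L/ℚ)` with the relations of Zywina's generators of
`G₉ ⊂ GL₂(𝔽₅)` ([Zywina2015, §1.3]: `u = diag(1,2)`, `w = (0 −1; 1 0)`, `t = (1 1; 1 −1)`; write `c = w² = −1`, `s = u² = diag(1,−1)`):
`u⁴ = 1`, `w⁴ = 1`, `w²u = uw²`, `w u² w⁻¹ = w²u²`, `w²t = tw²`, `t u² t⁻¹ = w u²`.  Then «`μ = 0` for every cyclotomic `ℤ_p`-extension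
of `L`» follows — with NO named fact (no growth theorem, no Ferrero–Washington) — from the same statement for the SIX fixed fields

  `L^{⟨u⟩}` (`= ℚ(P)`, degree 24), `L^{⟨w², u²⟩}` (`= ℚ(x(P), x(Q))`, 24), `L^{⟨u w²⟩}` (24), `L^{⟨w⟩}` (24),
  `L^{⟨u, w²⟩}` (`= ℚ(x(P))`, 12), `L^{⟨w, u²⟩}` (12; `⟨w, s⟩` is dihedral of order 8).

Road (three RELATIVE Klein steps `classicalMuVanishes_of_isCyclotomic_of_relative_biquadratic`, each a Kuroda EQUALITY at every layer of
the cyclotomic tower, [Lemmermeyer1994] §1, plus two conjugation transports):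
(3) `N = ⟨c⟩` with `w, s` (`w² = c`, `s² = 1`, `[w, s] = c`): `μ(L^{⟨c⟩})` from `L^{⟨w⟩}`, `L^{⟨c,s⟩}`, `L^{⟨c, ws⟩} = t·L^{⟨c,s⟩}`
    (`t s t⁻¹ = ws`, `t c t⁻¹ = c`), `L^{⟨w,s⟩}`;
(2) `N = ⟨s⟩` with `u, c` (`u² = s`, `c² = 1`, `[u, c] = 1`): `μ(L^{⟨s⟩})` from `L^{⟨u⟩}`, `L^{⟨c,s⟩}`, `L^{⟨uc⟩}` (`(uc)² = s`), `L^{⟨u,c⟩}`;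
    and `μ(L^{⟨cs⟩})` by transport along `w` (`w s w⁻¹ = cs`);
(1) `N = 1` with `c, s`: `μ(L)` from `L^{⟨c⟩}`, `L^{⟨s⟩}`, `L^{⟨cs⟩}`, `L^{⟨c,s⟩}`.
In `G₉`: `⟨c⟩ = Z(G₉) ∩ SL₂`-part `{±1}`, `Ṽ = ⟨Z, s, w⟩ ⊲ G₉` (order 16, image the Klein four-group of `𝔖₄`), `N_s(5) = ⟨u, w⟩·Z`.
The six inputs are what the unit norm-index door (`ClassicalMuVanishesUnitNormIndex.lean`), Iwasawa 1956 or Fukuda 1994 decide per row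
from class-group numerics of fields of degree ≤ 24.

References: [Zywina2015, §1.3]; [Lemmermeyer1994, §1]; [Washington1997, §13.1]; [MilneFT2022, Ch. 3]; [Serre1972, §2.5–2.6].
-/

noncomputable section

open scoped NumberField

open Field IntermediateField Literature.NumberTheory.EllipticCurves

namespace Literature.NumberTheory.IwasawaTheory

variable {p : ℕ} [Fact p.Prime]

omit [Fact p.Prime] in
/-- `p ∤ [E : ℚ]` for an intermediate field `E` of `L/ℚ` when `p ∤ [L : ℚ]`. [folklore] -/
private theorem not_dvd_finrank_intermediateField₉ {L : Type} [Field L] [NumberField L]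
    (hp : ¬ p ∣ Module.finrank ℚ L) (E : IntermediateField ℚ L) : ¬ p ∣ Module.finrank ℚ ↥E := fun h =>
  hp (h.trans (Dvd.intro _ (Module.finrank_mul_finrank ℚ ↥E L)))

omit [Fact p.Prime] in
/-- An element commuting with `h` normalises `⟨h⟩`. [folklore] -/
private theorem mem_normalizer_zpowers_of_commute₉ {G : Type} [Group G] {g h : G} (hc : Commute g h) :
    g ∈ Subgroup.normalizer (Subgroup.zpowers h : Set G) := by
  rw [Subgroup.mem_normalizer_iff]
  intro k
  constructor
  · intro hk
    obtain ⟨m, rfl⟩ := Subgroup.mem_zpowers_iff.mp hk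
    rw [(hc.zpow_right m).eq, mul_inv_cancel_right]
    exact hk
  · intro hk
    obtain ⟨m, hm⟩ := Subgroup.mem_zpowers_iff.mp hk
    have h1 : k = g⁻¹ * h ^ m * g := by rw [hm]; group
    rw [h1, (hc.inv_left.zpow_right m).eq, inv_mul_cancel_right]
    exact Subgroup.zpow_mem _ (Subgroup.mem_zpowers h) m

omit [Fact p.Prime] in
/-- Everything normalises the trivial subgroup. [folklore] -/
private theorem mem_normalizer_bot₉ {G : Type} [Group G] (g : G) :
    g ∈ Subgroup.normalizer ((⊥ : Subgroup G) : Set G) := by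
  rw [Subgroup.mem_normalizer_iff]
  intro k
  simp only [Subgroup.mem_bot]
  constructor
  · intro hk; rw [hk, mul_one, mul_inv_cancel]
  · intro hk
    have : k = g⁻¹ * (g * k * g⁻¹) * g := by group
    rw [this, hk, mul_one, inv_mul_cancel]

/-- Transport of «`μ = 0` for every cyclotomic `ℤ_p`-extension» between fixed fields of EQUAL subgroups. [folklore] -/
private theorem forall_classicalMuVanishes_of_subgroup_eq₉ {L : Type} [Field L] [NumberField L]
    (hp : ¬ p ∣ Module.finrank ℚ L) {S T : Subgroup (L ≃ₐ[ℚ] L)} (hST : S = T)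
    (h : ∀ κE : ZpExtension ↥(fixedField S) p, κE.IsCyclotomic → ClassicalMuVanishes κE) :
    ∀ κE : ZpExtension ↥(fixedField T) p, κE.IsCyclotomic → ClassicalMuVanishes κE :=
  forall_classicalMuVanishes_of_algEquiv (F := ℚ) (IntermediateField.equivOfEq (congrArg fixedField hST))
    (not_dvd_finrank_intermediateField₉ hp _) h

/-- Transport along conjugation: `L^{g S g⁻¹}` from `L^S`. [folklore] -/
private theorem forall_classicalMuVanishes_of_conj₉ {L : Type} [Field L] [NumberField L]
    (hp : ¬ p ∣ Module.finrank ℚ L) (S T : Subgroup (L ≃ₐ[ℚ] L)) (g : L ≃ₐ[ℚ] L)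
    (hST : S.map (MulAut.conj g).toMonoidHom = T)
    (h : ∀ κE : ZpExtension ↥(fixedField S) p, κE.IsCyclotomic → ClassicalMuVanishes κE) :
    ∀ κE : ZpExtension ↥(fixedField T) p, κE.IsCyclotomic → ClassicalMuVanishes κE := by
  haveI : FiniteDimensional ℚ L := inferInstance
  obtain ⟨φ⟩ := nonempty_algEquiv_fixedField_conj (F := ℚ) S g
  exact forall_classicalMuVanishes_of_algEquiv (F := ℚ) (φ.trans (IntermediateField.equivOfEq (congrArg fixedField hST)))
    (not_dvd_finrank_intermediateField₉ hp _) h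

omit [Fact p.Prime] in
/-- `⟨a⟩ ⊔ ⟨b⟩ = ⟨b⟩` when `a ∈ ⟨b⟩`. [folklore] -/
private theorem zpowers_sup_eq_of_mem₉ {G : Type} [Group G] {a b : G} (h : a ∈ Subgroup.zpowers b) :
    Subgroup.zpowers a ⊔ Subgroup.zpowers b = Subgroup.zpowers b :=
  sup_eq_right.mpr ((Subgroup.zpowers_le).mpr h)

omit [Fact p.Prime] in
/-- Conjugating `⟨a⟩ ⊔ ⟨b⟩`: `g(⟨a⟩ ⊔ ⟨b⟩)g⁻¹ = ⟨gag⁻¹⟩ ⊔ ⟨gbg⁻¹⟩`. [folklore] -/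
private theorem map_conj_zpowers_sup₉ {G : Type} [Group G] (g a b : G) :
    (Subgroup.zpowers a ⊔ Subgroup.zpowers b).map (MulAut.conj g).toMonoidHom =
      Subgroup.zpowers (g * a * g⁻¹) ⊔ Subgroup.zpowers (g * b * g⁻¹) := by
  rw [Subgroup.map_sup, MonoidHom.map_zpowers, MonoidHom.map_zpowers]
  rfl

set_option maxHeartbeats 1600000 in
/-- **The `G₉ = 5S4` census form, fact-free: `μ(L) = 0` from six small fixed fields.**  `L/ℚ` finite Galois, `p` odd, `p ∤ [L:ℚ]`;
`u, w, t ∈ Gal(L/ℚ)` with `u⁴ = 1`, `w⁴ = 1`, `w²u = uw²`, `w u² w⁻¹ = w²u²`, `w²t = tw²`, `t u² t⁻¹ = w u²` (the relations of Zywina's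
generators `diag(1,2)`, `(0 −1; 1 0)`, `(1 1; 1 −1)` of `G₉ ⊂ GL₂(𝔽₅)`; `c = w² = −1`, `s = u² = diag(1,−1)`).  If «`μ = 0` for every
cyclotomic `ℤ_p`-extension» holds for the fixed fields of `⟨u⟩`, `⟨w², u²⟩`, `⟨u w²⟩`, `⟨w⟩`, `⟨u, w²⟩`, `⟨w, u²⟩`, then it holds for `L`.
For `L = ℚ(E[5])` with image `G₉`: `L^{⟨u⟩} = ℚ(P)` (degree 24), `L^{⟨w²,u²⟩} = ℚ(x(P), x(Q))` (24), `L^{⟨uw²⟩}` (24), `L^{⟨w⟩}` (24),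
`L^{⟨u,w²⟩} = ℚ(x(P))` (12), `L^{⟨w,u²⟩}` (12).  Three relative Klein steps and two conjugation transports (module docstring); NO named
fact is used. [cite: Lemmermeyer1994, §1 (Kuroda's class number formula, odd part)] [cite: Washington1997, §13.1]
[cite: MilneFT2022, Ch. 3 (Galois correspondence)] [cite: Zywina2015, §1.3 (G₉ and its generators)] -/
theorem classicalMuVanishes_of_isCyclotomic_of_zywinaG9_kuroda_rat (hp2 : p ≠ 2)
    (L : Type) [Field L] [NumberField L] [IsGalois ℚ L] (hp : ¬ p ∣ Module.finrank ℚ L)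
    {u w t : L ≃ₐ[ℚ] L} (hu : u ^ 4 = 1) (hw : w ^ 4 = 1) (hcu : w ^ 2 * u = u * w ^ 2)
    (hwu : w * u ^ 2 * w⁻¹ = w ^ 2 * u ^ 2) (hct : w ^ 2 * t = t * w ^ 2) (htu : t * u ^ 2 * t⁻¹ = w * u ^ 2)
    (hμP : ∀ κE : ZpExtension ↥(fixedField (Subgroup.zpowers u)) p, κE.IsCyclotomic → ClassicalMuVanishes κE)
    (hμA₁ : ∀ κE : ZpExtension ↥(fixedField (Subgroup.zpowers (w ^ 2) ⊔ Subgroup.zpowers (u ^ 2))) p,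
      κE.IsCyclotomic → ClassicalMuVanishes κE)
    (hμA₂ : ∀ κE : ZpExtension ↥(fixedField (Subgroup.zpowers (u * w ^ 2))) p, κE.IsCyclotomic → ClassicalMuVanishes κE)
    (hμA₃ : ∀ κE : ZpExtension ↥(fixedField (Subgroup.zpowers w)) p, κE.IsCyclotomic → ClassicalMuVanishes κE)
    (hμB₁ : ∀ κE : ZpExtension ↥(fixedField (Subgroup.zpowers u ⊔ Subgroup.zpowers (w ^ 2))) p,
      κE.IsCyclotomic → ClassicalMuVanishes κE)
    (hμD : ∀ κE : ZpExtension ↥(fixedField (Subgroup.zpowers w ⊔ Subgroup.zpowers (u ^ 2))) p,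
      κE.IsCyclotomic → ClassicalMuVanishes κE)
    (κL : ZpExtension L p) (hκL : κL.IsCyclotomic) : ClassicalMuVanishes κL := by
  haveI : FiniteDimensional ℚ L := inferInstance
  -- bookkeeping: `c = w²` is central for `u, w, t`; `s = u²`
  have hc2 : w ^ 2 * w ^ 2 = 1 := by rw [← pow_add, hw]
  have hs2 : u ^ 2 * u ^ 2 = 1 := by rw [← pow_add, hu]
  have hcomm_cu : Commute (w ^ 2) u := hcu
  have hcomm_cs : Commute (w ^ 2) (u ^ 2) := hcomm_cu.pow_right 2
  have hcomm_ww : Commute w (w ^ 2) := (Commute.refl w).pow_right 2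
  have hcomm_uu : Commute u (u ^ 2) := (Commute.refl u).pow_right 2
  have hw2w : w ^ 2 ∈ Subgroup.zpowers w := Subgroup.pow_mem _ (Subgroup.mem_zpowers w) 2
  have hu2u : u ^ 2 ∈ Subgroup.zpowers u := Subgroup.pow_mem _ (Subgroup.mem_zpowers u) 2
  -- `(u w²)² = u²`
  have hA2sq : (u * w ^ 2) * (u * w ^ 2) = u ^ 2 := by
    calc (u * w ^ 2) * (u * w ^ 2) = u * (w ^ 2 * u) * w ^ 2 := by group
      _ = u * (u * w ^ 2) * w ^ 2 := by rw [hcu]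
      _ = u * u * (w ^ 2 * w ^ 2) := by group
      _ = u ^ 2 := by rw [hc2, mul_one, pow_two]
  have hu2A2 : u ^ 2 ∈ Subgroup.zpowers (u * w ^ 2) := by
    rw [← hA2sq]; exact Subgroup.mul_mem _ (Subgroup.mem_zpowers _) (Subgroup.mem_zpowers _)
  ------------------------------------------------------------------
  -- STEP (3): `μ(L^{⟨c⟩})` from `L^{⟨w⟩}`, `L^{⟨c,s⟩}`, `L^{⟨c,ws⟩} = t L^{⟨c,s⟩}`, `L^{⟨w,s⟩}`
  ------------------------------------------------------------------
  have hconj₃ : (Subgroup.zpowers (w ^ 2) ⊔ Subgroup.zpowers (u ^ 2)).map (MulAut.conj t).toMonoidHom =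
      Subgroup.zpowers (w ^ 2) ⊔ Subgroup.zpowers (w * u ^ 2) := by
    rw [map_conj_zpowers_sup₉, htu]
    congr 2
    rw [← hct, mul_inv_cancel_right]
  have hμC : ∀ κE : ZpExtension ↥(fixedField (Subgroup.zpowers (w ^ 2))) p,
      κE.IsCyclotomic → ClassicalMuVanishes κE := by
    refine classicalMuVanishes_of_isCyclotomic_of_relative_biquadratic hp2 L hp (Subgroup.zpowers (w ^ 2))
      (x := w) (y := u ^ 2) (mem_normalizer_zpowers_of_commute₉ hcomm_ww) (mem_normalizer_zpowers_of_commute₉ hcomm_cs.symm)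
      ?_ ?_ ?_ ?_ hμA₁ ?_ ?_
    · rw [← pow_two]; exact Subgroup.mem_zpowers _
    · rw [hs2]; exact Subgroup.one_mem _
    · -- `w s w⁻¹ s⁻¹ = c s s⁻¹ = c`
      rw [hwu, mul_inv_cancel_right]
      exact Subgroup.mem_zpowers _
    · exact forall_classicalMuVanishes_of_subgroup_eq₉ hp (zpowers_sup_eq_of_mem₉ hw2w).symm hμA₃
    · exact forall_classicalMuVanishes_of_conj₉ hp _ _ t hconj₃ hμA₁
    · refine forall_classicalMuVanishes_of_subgroup_eq₉ hp ?_ hμD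
      rw [zpowers_sup_eq_of_mem₉ hw2w]
  ------------------------------------------------------------------
  -- STEP (2): `μ(L^{⟨s⟩})` from `L^{⟨u⟩}`, `L^{⟨c,s⟩}`, `L^{⟨uc⟩}`, `L^{⟨u,c⟩}`; then `μ(L^{⟨cs⟩})` along `w`
  ------------------------------------------------------------------
  have hμS : ∀ κE : ZpExtension ↥(fixedField (Subgroup.zpowers (u ^ 2))) p,
      κE.IsCyclotomic → ClassicalMuVanishes κE := by
    refine classicalMuVanishes_of_isCyclotomic_of_relative_biquadratic hp2 L hp (Subgroup.zpowers (u ^ 2))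
      (x := u) (y := w ^ 2) (mem_normalizer_zpowers_of_commute₉ hcomm_uu) (mem_normalizer_zpowers_of_commute₉ hcomm_cs)
      ?_ ?_ ?_ ?_ ?_ ?_ ?_
    · rw [← pow_two]; exact Subgroup.mem_zpowers _
    · rw [hc2]; exact Subgroup.one_mem _
    · rw [← hcu, mul_inv_cancel_right, mul_inv_cancel]; exact Subgroup.one_mem _
    · exact forall_classicalMuVanishes_of_subgroup_eq₉ hp (zpowers_sup_eq_of_mem₉ hu2u).symm hμP
    · exact forall_classicalMuVanishes_of_subgroup_eq₉ hp (sup_comm _ _) hμA₁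
    · exact forall_classicalMuVanishes_of_subgroup_eq₉ hp (zpowers_sup_eq_of_mem₉ hu2A2).symm hμA₂
    · refine forall_classicalMuVanishes_of_subgroup_eq₉ hp ?_ hμB₁
      rw [zpowers_sup_eq_of_mem₉ hu2u]
  have hconj₂ : (Subgroup.zpowers (u ^ 2)).map (MulAut.conj w).toMonoidHom = Subgroup.zpowers (w ^ 2 * u ^ 2) := by
    rw [MonoidHom.map_zpowers, ← hwu]
    rfl
  have hμSc : ∀ κE : ZpExtension ↥(fixedField (Subgroup.zpowers (w ^ 2 * u ^ 2))) p,
      κE.IsCyclotomic → ClassicalMuVanishes κE :=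
    forall_classicalMuVanishes_of_conj₉ hp _ _ w hconj₂ hμS
  ------------------------------------------------------------------
  -- STEP (1): `μ(L)` from `L^{⟨c⟩}`, `L^{⟨s⟩}`, `L^{⟨cs⟩}`, `L^{⟨c,s⟩}`
  ------------------------------------------------------------------
  have hμbot : ∀ κE : ZpExtension ↥(fixedField (⊥ : Subgroup (L ≃ₐ[ℚ] L))) p,
      κE.IsCyclotomic → ClassicalMuVanishes κE := by
    refine classicalMuVanishes_of_isCyclotomic_of_relative_biquadratic hp2 L hp ⊥
      (x := w ^ 2) (y := u ^ 2) (mem_normalizer_bot₉ _) (mem_normalizer_bot₉ _) ?_ ?_ ?_ ?_ ?_ ?_ ?_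
    · rw [hc2]; exact Subgroup.one_mem _
    · rw [hs2]; exact Subgroup.one_mem _
    · rw [hcomm_cs.eq, mul_inv_cancel_right, mul_inv_cancel]; exact Subgroup.one_mem _
    · exact forall_classicalMuVanishes_of_subgroup_eq₉ hp (bot_sup_eq _).symm hμC
    · exact forall_classicalMuVanishes_of_subgroup_eq₉ hp (bot_sup_eq _).symm hμS
    · exact forall_classicalMuVanishes_of_subgroup_eq₉ hp (bot_sup_eq _).symm hμSc
    · refine forall_classicalMuVanishes_of_subgroup_eq₉ hp ?_ hμA₁
      rw [bot_sup_eq]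
  -- `L^{1} = L`
  have e : ↥(fixedField (⊥ : Subgroup (L ≃ₐ[ℚ] L))) ≃ₐ[ℚ] L :=
    (IntermediateField.equivOfEq (fixedField_bot (F := ℚ) (E := L))).trans IntermediateField.topEquiv
  exact forall_classicalMuVanishes_of_algEquiv (F := ℚ) e (not_dvd_finrank_intermediateField₉ hp _) hμbot κL hκL

/-! ## APPEND (same seat, 2026-08-28): the alternative chain through the `𝔖₄`-field `L^Z` (leaves `B₂ = L^{⟨i,s⟩}`, `B₃ = L^{⟨i,w⟩}`,
`S₆ = L^{Ṽ}` instead of `D = L^{⟨w,s⟩}`), matching the kit census leaf set `QP, A1, A2, A3 = ⟨is⟩, B1, B2, B3, S6` -/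

omit [Fact p.Prime] in
/-- `⟨z⟩ ⊔ ⟨a⟩ = ⟨z⟩ ⊔ ⟨b⟩` when `a = zᵏ b` for some power of `z`. [folklore] -/
private theorem zpowers_sup_zpowers_eq_of_eq_mul₉ {G : Type} [Group G] {z a b : G} {k : ℕ} (h : a = z ^ k * b) :
    Subgroup.zpowers z ⊔ Subgroup.zpowers a = Subgroup.zpowers z ⊔ Subgroup.zpowers b := by
  have hzk : z ^ k ∈ Subgroup.zpowers z ⊔ Subgroup.zpowers b :=
    Subgroup.mem_sup_left (Subgroup.pow_mem _ (Subgroup.mem_zpowers z) k)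
  have hzk' : z ^ k ∈ Subgroup.zpowers z ⊔ Subgroup.zpowers a :=
    Subgroup.mem_sup_left (Subgroup.pow_mem _ (Subgroup.mem_zpowers z) k)
  apply le_antisymm
  · refine sup_le le_sup_left ((Subgroup.zpowers_le).mpr ?_)
    rw [h]; exact Subgroup.mul_mem _ hzk (Subgroup.mem_sup_right (Subgroup.mem_zpowers b))
  · refine sup_le le_sup_left ((Subgroup.zpowers_le).mpr ?_)
    have hb : b = (z ^ k)⁻¹ * a := by rw [h, inv_mul_cancel_left]
    rw [hb]; exact Subgroup.mul_mem _ (Subgroup.inv_mem _ hzk') (Subgroup.mem_sup_right (Subgroup.mem_zpowers a))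

set_option maxHeartbeats 1600000 in
/-- **The `G₉ = 5S4` census form through the `𝔖₄`-field, fact-free: `μ(L) = 0` from eight small fixed fields.**  As
`classicalMuVanishes_of_isCyclotomic_of_zywinaG9_kuroda_rat`, with the centre made explicit: `i := t²` (`= 2·1` for Zywina's `t = (1 1; 1 −1)`)
is central of order `4` with `i² = c = w²`: hypotheses `u⁴ = 1`, `w⁴ = 1`, `w²u = uw²`, `w u² w⁻¹ = w²u²`, `t²u = ut²`, `t²w = wt²`, `w² = t⁴`,
`t u² t⁻¹ = w u²`.  If «`μ = 0` for every cyclotomic `ℤ_p`-extension» holds for the fixed fields of `⟨u⟩` (ℚ(P), 24), `⟨w², u²⟩` (24), `⟨u w²⟩`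
(24), `⟨t² u²⟩` (24), `⟨u, w²⟩` (12), `⟨t², u²⟩` (12), `⟨t², w⟩` (12), `⟨t², u², w⟩` (6, the `𝔖₃`-sextic `L^{Ṽ}`), then it holds for `L`.  Road:
(4) `N = Z = ⟨t²⟩` with `s = u², w` (`s² = 1`, `w² = c ∈ Z`, `[s, w] = c`): `μ(L^Z)` from `L^{⟨Z,s⟩}`, `L^{⟨Z,w⟩}`, `L^{⟨Z,sw⟩} = t·L^{⟨Z,s⟩}`, `L^{Ṽ}`;
(3) `N = ⟨c⟩` with `i, s` (`i² = c`, `[i,s] = 1`): `μ(L^{⟨c⟩})` from `L^Z`, `L^{⟨c,s⟩}`, `L^{⟨is⟩}`, `L^{⟨i,s⟩}`; then steps (2), (2′), (1) of the main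
theorem.  NO named fact. [cite: Lemmermeyer1994, §1 (Kuroda's class number formula, odd part)] [cite: Washington1997, §13.1]
[cite: Zywina2015, §1.3 (G₉ and its generators)] -/
theorem classicalMuVanishes_of_isCyclotomic_of_zywinaG9_kuroda_rat_central (hp2 : p ≠ 2)
    (L : Type) [Field L] [NumberField L] [IsGalois ℚ L] (hp : ¬ p ∣ Module.finrank ℚ L)
    {u w t : L ≃ₐ[ℚ] L} (hu : u ^ 4 = 1) (hw : w ^ 4 = 1) (hcu : w ^ 2 * u = u * w ^ 2)
    (hwu : w * u ^ 2 * w⁻¹ = w ^ 2 * u ^ 2) (htu' : t ^ 2 * u = u * t ^ 2) (htw : t ^ 2 * w = w * t ^ 2) (hwt : w ^ 2 = t ^ 4)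
    (htu : t * u ^ 2 * t⁻¹ = w * u ^ 2)
    (hμP : ∀ κE : ZpExtension ↥(fixedField (Subgroup.zpowers u)) p, κE.IsCyclotomic → ClassicalMuVanishes κE)
    (hμA₁ : ∀ κE : ZpExtension ↥(fixedField (Subgroup.zpowers (w ^ 2) ⊔ Subgroup.zpowers (u ^ 2))) p,
      κE.IsCyclotomic → ClassicalMuVanishes κE)
    (hμA₂ : ∀ κE : ZpExtension ↥(fixedField (Subgroup.zpowers (u * w ^ 2))) p, κE.IsCyclotomic → ClassicalMuVanishes κE)
    (hμA₃ : ∀ κE : ZpExtension ↥(fixedField (Subgroup.zpowers (t ^ 2 * u ^ 2))) p, κE.IsCyclotomic → ClassicalMuVanishes κE)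
    (hμB₁ : ∀ κE : ZpExtension ↥(fixedField (Subgroup.zpowers u ⊔ Subgroup.zpowers (w ^ 2))) p,
      κE.IsCyclotomic → ClassicalMuVanishes κE)
    (hμB₂ : ∀ κE : ZpExtension ↥(fixedField (Subgroup.zpowers (t ^ 2) ⊔ Subgroup.zpowers (u ^ 2))) p,
      κE.IsCyclotomic → ClassicalMuVanishes κE)
    (hμB₃ : ∀ κE : ZpExtension ↥(fixedField (Subgroup.zpowers (t ^ 2) ⊔ Subgroup.zpowers w)) p,
      κE.IsCyclotomic → ClassicalMuVanishes κE)
    (hμS₆ : ∀ κE : ZpExtension ↥(fixedField (Subgroup.zpowers (t ^ 2) ⊔ Subgroup.zpowers (u ^ 2) ⊔ Subgroup.zpowers w)) p,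
      κE.IsCyclotomic → ClassicalMuVanishes κE)
    (κL : ZpExtension L p) (hκL : κL.IsCyclotomic) : ClassicalMuVanishes κL := by
  haveI : FiniteDimensional ℚ L := inferInstance
  -- bookkeeping: `i = t²`, `c = w² = t⁴`, `s = u²`
  have hc2 : w ^ 2 * w ^ 2 = 1 := by rw [← pow_add, hw]
  have hs2 : u ^ 2 * u ^ 2 = 1 := by rw [← pow_add, hu]
  have hcomm_cu : Commute (w ^ 2) u := hcu
  have hcomm_cs : Commute (w ^ 2) (u ^ 2) := hcomm_cu.pow_right 2
  have hcomm_uu : Commute u (u ^ 2) := (Commute.refl u).pow_right 2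
  have hcomm_iu : Commute (t ^ 2) u := htu'
  have hcomm_is : Commute (t ^ 2) (u ^ 2) := hcomm_iu.pow_right 2
  have hcomm_iw : Commute (t ^ 2) w := htw
  have hcomm_ic : Commute (t ^ 2) (w ^ 2) := hcomm_iw.pow_right 2
  have hu2u : u ^ 2 ∈ Subgroup.zpowers u := Subgroup.pow_mem _ (Subgroup.mem_zpowers u) 2
  have hcZ : w ^ 2 ∈ Subgroup.zpowers (t ^ 2) := by
    rw [hwt, show t ^ 4 = (t ^ 2) ^ 2 by rw [← pow_mul]]; exact Subgroup.pow_mem _ (Subgroup.mem_zpowers _) 2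
  -- `(u w²)² = u²`
  have hA2sq : (u * w ^ 2) * (u * w ^ 2) = u ^ 2 := by
    calc (u * w ^ 2) * (u * w ^ 2) = u * (w ^ 2 * u) * w ^ 2 := by group
      _ = u * (u * w ^ 2) * w ^ 2 := by rw [hcu]
      _ = u * u * (w ^ 2 * w ^ 2) := by group
      _ = u ^ 2 := by rw [hc2, mul_one, pow_two]
  have hu2A2 : u ^ 2 ∈ Subgroup.zpowers (u * w ^ 2) := by
    rw [← hA2sq]; exact Subgroup.mul_mem _ (Subgroup.mem_zpowers _) (Subgroup.mem_zpowers _)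
  -- `(i s)² = c`
  have hA3sq : (t ^ 2 * u ^ 2) * (t ^ 2 * u ^ 2) = w ^ 2 := by
    calc (t ^ 2 * u ^ 2) * (t ^ 2 * u ^ 2) = t ^ 2 * (u ^ 2 * t ^ 2) * u ^ 2 := by group
      _ = t ^ 2 * (t ^ 2 * u ^ 2) * u ^ 2 := by rw [hcomm_is.eq]
      _ = t ^ 2 * t ^ 2 * (u ^ 2 * u ^ 2) := by group
      _ = w ^ 2 := by rw [hs2, mul_one, ← pow_add, ← hwt]
  have hcA3 : w ^ 2 ∈ Subgroup.zpowers (t ^ 2 * u ^ 2) := by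
    rw [← hA3sq]; exact Subgroup.mul_mem _ (Subgroup.mem_zpowers _) (Subgroup.mem_zpowers _)
  ------------------------------------------------------------------
  -- STEP (4): `μ(L^Z)` from `L^{⟨Z,s⟩}`, `L^{⟨Z,w⟩}`, `L^{⟨Z,sw⟩} = t L^{⟨Z,s⟩}`, `L^{Ṽ}`
  ------------------------------------------------------------------
  have hconj₄ : (Subgroup.zpowers (t ^ 2) ⊔ Subgroup.zpowers (u ^ 2)).map (MulAut.conj t).toMonoidHom =
      Subgroup.zpowers (t ^ 2) ⊔ Subgroup.zpowers (u ^ 2 * w) := by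
    rw [map_conj_zpowers_sup₉, htu]
    have h1 : t * t ^ 2 * t⁻¹ = t ^ 2 := by group
    rw [h1]
    -- `w u² = c · (u² w) = (t²)² · (u² w)`
    refine zpowers_sup_zpowers_eq_of_eq_mul₉ (k := 2) ?_
    calc w * u ^ 2 = w * u ^ 2 * w⁻¹ * w := by rw [inv_mul_cancel_right]
      _ = w ^ 2 * u ^ 2 * w := by rw [hwu]
      _ = (t ^ 2) ^ 2 * (u ^ 2 * w) := by rw [hwt, ← pow_mul, mul_assoc]
  have hμF : ∀ κE : ZpExtension ↥(fixedField (Subgroup.zpowers (t ^ 2))) p,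
      κE.IsCyclotomic → ClassicalMuVanishes κE := by
    refine classicalMuVanishes_of_isCyclotomic_of_relative_biquadratic hp2 L hp (Subgroup.zpowers (t ^ 2))
      (x := u ^ 2) (y := w) (mem_normalizer_zpowers_of_commute₉ hcomm_is.symm) (mem_normalizer_zpowers_of_commute₉ hcomm_iw.symm)
      ?_ ?_ ?_ hμB₂ hμB₃ ?_ hμS₆
    · rw [hs2]; exact Subgroup.one_mem _
    · rw [← pow_two]; exact hcZ
    · -- `s w s⁻¹ w⁻¹ = s (w s w⁻¹)⁻¹ = s (c s)⁻¹ = c⁻¹`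
      have h1 : u ^ 2 * w * (u ^ 2)⁻¹ * w⁻¹ = u ^ 2 * (w * u ^ 2 * w⁻¹)⁻¹ := by group
      rw [h1, hwu, mul_inv_rev, ← mul_assoc, mul_inv_cancel, one_mul]
      exact Subgroup.inv_mem _ hcZ
    · exact forall_classicalMuVanishes_of_conj₉ hp _ _ t hconj₄ hμB₂
  ------------------------------------------------------------------
  -- STEP (3): `μ(L^{⟨c⟩})` from `L^Z`, `L^{⟨c,s⟩}`, `L^{⟨is⟩}`, `L^{⟨i,s⟩}`
  ------------------------------------------------------------------
  have hμC : ∀ κE : ZpExtension ↥(fixedField (Subgroup.zpowers (w ^ 2))) p,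
      κE.IsCyclotomic → ClassicalMuVanishes κE := by
    refine classicalMuVanishes_of_isCyclotomic_of_relative_biquadratic hp2 L hp (Subgroup.zpowers (w ^ 2))
      (x := t ^ 2) (y := u ^ 2) (mem_normalizer_zpowers_of_commute₉ hcomm_ic) (mem_normalizer_zpowers_of_commute₉ hcomm_cs.symm)
      ?_ ?_ ?_ ?_ hμA₁ ?_ ?_
    · rw [← pow_add, ← hwt]; exact Subgroup.mem_zpowers _
    · rw [hs2]; exact Subgroup.one_mem _
    · rw [hcomm_is.eq, mul_inv_cancel_right, mul_inv_cancel]; exact Subgroup.one_mem _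
    · exact forall_classicalMuVanishes_of_subgroup_eq₉ hp (zpowers_sup_eq_of_mem₉ hcZ).symm hμF
    · exact forall_classicalMuVanishes_of_subgroup_eq₉ hp (zpowers_sup_eq_of_mem₉ hcA3).symm hμA₃
    · refine forall_classicalMuVanishes_of_subgroup_eq₉ hp ?_ hμB₂
      rw [zpowers_sup_eq_of_mem₉ hcZ]
  ------------------------------------------------------------------
  -- STEPS (2), (2′), (1): verbatim from the main theorem
  ------------------------------------------------------------------
  have hμS : ∀ κE : ZpExtension ↥(fixedField (Subgroup.zpowers (u ^ 2))) p,
      κE.IsCyclotomic → ClassicalMuVanishes κE := by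
    refine classicalMuVanishes_of_isCyclotomic_of_relative_biquadratic hp2 L hp (Subgroup.zpowers (u ^ 2))
      (x := u) (y := w ^ 2) (mem_normalizer_zpowers_of_commute₉ hcomm_uu) (mem_normalizer_zpowers_of_commute₉ hcomm_cs)
      ?_ ?_ ?_ ?_ ?_ ?_ ?_
    · rw [← pow_two]; exact Subgroup.mem_zpowers _
    · rw [hc2]; exact Subgroup.one_mem _
    · rw [← hcu, mul_inv_cancel_right, mul_inv_cancel]; exact Subgroup.one_mem _
    · exact forall_classicalMuVanishes_of_subgroup_eq₉ hp (zpowers_sup_eq_of_mem₉ hu2u).symm hμP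
    · exact forall_classicalMuVanishes_of_subgroup_eq₉ hp (sup_comm _ _) hμA₁
    · exact forall_classicalMuVanishes_of_subgroup_eq₉ hp (zpowers_sup_eq_of_mem₉ hu2A2).symm hμA₂
    · refine forall_classicalMuVanishes_of_subgroup_eq₉ hp ?_ hμB₁
      rw [zpowers_sup_eq_of_mem₉ hu2u]
  have hconj₂ : (Subgroup.zpowers (u ^ 2)).map (MulAut.conj w).toMonoidHom = Subgroup.zpowers (w ^ 2 * u ^ 2) := by
    rw [MonoidHom.map_zpowers, ← hwu]
    rfl
  have hμSc : ∀ κE : ZpExtension ↥(fixedField (Subgroup.zpowers (w ^ 2 * u ^ 2))) p,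
      κE.IsCyclotomic → ClassicalMuVanishes κE :=
    forall_classicalMuVanishes_of_conj₉ hp _ _ w hconj₂ hμS
  have hμbot : ∀ κE : ZpExtension ↥(fixedField (⊥ : Subgroup (L ≃ₐ[ℚ] L))) p,
      κE.IsCyclotomic → ClassicalMuVanishes κE := by
    refine classicalMuVanishes_of_isCyclotomic_of_relative_biquadratic hp2 L hp ⊥
      (x := w ^ 2) (y := u ^ 2) (mem_normalizer_bot₉ _) (mem_normalizer_bot₉ _) ?_ ?_ ?_ ?_ ?_ ?_ ?_
    · rw [hc2]; exact Subgroup.one_mem _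
    · rw [hs2]; exact Subgroup.one_mem _
    · rw [hcomm_cs.eq, mul_inv_cancel_right, mul_inv_cancel]; exact Subgroup.one_mem _
    · exact forall_classicalMuVanishes_of_subgroup_eq₉ hp (bot_sup_eq _).symm hμC
    · exact forall_classicalMuVanishes_of_subgroup_eq₉ hp (bot_sup_eq _).symm hμS
    · exact forall_classicalMuVanishes_of_subgroup_eq₉ hp (bot_sup_eq _).symm hμSc
    · refine forall_classicalMuVanishes_of_subgroup_eq₉ hp ?_ hμA₁
      rw [bot_sup_eq]
  have e : ↥(fixedField (⊥ : Subgroup (L ≃ₐ[ℚ] L))) ≃ₐ[ℚ] L :=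
    (IntermediateField.equivOfEq (fixedField_bot (F := ℚ) (E := L))).trans IntermediateField.topEquiv
  exact forall_classicalMuVanishes_of_algEquiv (F := ℚ) e (not_dvd_finrank_intermediateField₉ hp _) hμbot κL hκL

end Literature.NumberTheory.IwasawaTheory

end
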